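import Summits.ResolutionOfSingularities.ResolutionOfSingularities.Theorems.HilbertSamuelEliminationSigmaMaxModificationsEliminationIsModification
import Summits.ResolutionOfSingularities.ResolutionOfSingularities.Theorems.HilbertSamuelEliminationSigmaMaxModificationsGluing
import Summits.ResolutionOfSingularities.ResolutionOfSingularities.Theorems.HilbertSamuelEliminationSigmaMaxModificationsSemicontinuitySharp
import Summits.ResolutionOfSingularities.ResolutionOfSingularities.Theorems.HilbertSamuelEliminationSigmaMaxModificationsMaxLocusClosed
import Summits.ResolutionOfSingularities.ResolutionOfSingularities.Theorems.SigmaMaxModifications.Negative.Levels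
import Literature.AlgebraicGeometry.Resolution.HilbertSamuelLocal
import Literature.AlgebraicGeometry.Resolution.HilbertSamuelLowerBound
import Literature.AlgebraicGeometry.Resolution.HilbertSamuelIsolatedSingularities
import Literature.AlgebraicGeometry.Resolution.HilbertSamuelGenericConstancyExcellent
import Literature.AlgebraicGeometry.Resolution.ExcellentRingsFieldProofs
import Mathlib.AlgebraicGeometry.Morphisms.Proper
import Mathlib.AlgebraicGeometry.Noetherian
import HarnessLib

/-!
# `SigmaMaxModifications` (crux stmt-ResolutionOfSingularities-18506, line `Sketch`):
# stub `stub_levelRaise` — level raising `N → N + 1` on the class `dim ≤ N`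

Stub `stub_levelRaise` of the lead skeleton `Sketch` (reshape 5, level induction) for the crux
`Summit.ResolutionOfSingularities.ResolutionOfSingularities.Theses.HilbertSamuelElimination.SigmaMaxModifications`
(Cossart–Jannsen–Saito, LNM 2270, Def. 6.15: `Σ^max`-modifications of reduced separated finite
type `X/k` at every level `N ≥ dim X`). Write `B(X, N)` for the seven-clause body of the crux
(proper `π : X' → X`, `X'` reduced, `dim X' ≤ N`, `π` an isomorphism over every open inside
`X ∖ X_max(N)`, dense preimage of `X ∖ X_max(N)`, `H^N` non-increasing, no maximal value of
`Σ_X(N)` survives on `X'`). The stub is the induction step of the lead's level induction: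

> if `B(Y, N)` holds for every reduced separated finite-type non-regular `Y/k` with `dim Y ≤ N`,
> then `B(X, N + 1)` holds for every such `X` with `dim X ≤ N`.

This is the dimension-free form of the (private) step `surface_succ` of
`HilbertSamuelEliminationSigmaMaxModificationsSurfaceAllLevels.lean`; the proof is the same.

Proof. For `X/k` reduced of finite type, not regular, `dim X ≤ N`: let
`S = {μ | μ^{(1)} ∈ Σ^max_X(N+1)}` and `U₁ = {x | ∃ μ ∈ S, H^N_X(x) ≤ μ}`. Since the strata
`X_N(≥ λ)` are closed at `N ≥ dim X` (`stub_isClosed_hsMaxLocus_over_field` fed by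
`stub_hsFun_le_of_specializes_over_field`) and `Σ_X(N)` is finite, each `{H^N_X ≤ μ}` is open, so
`U₁` is OPEN; `X_max(N+1) ⊆ U₁` (`H^{N+1} = (H^N)^{(1)}`, CJS Rem. 2.29 (b)), and a value `μ`
is maximal in `Σ_{U₁}(N)` iff `μ ∈ S`, whence `(U₁)_max(N) = U₁ ∩ X_max(N+1)` on the nose. The
open subscheme `U₁` is reduced, separated and of finite type over `k`, of dimension `≤ N`, and
not regular (it contains the non-empty `X_max(N+1) ⊆ Sing X`), so the hypothesis gives a
level-`N` `Σ^max`-modification `ρ : Y → U₁`; read at level `N + 1` (monotonicity and (ME2) move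
up along `ν ↦ ν^{(1)}`, refuter kit `Negative/Levels`) it is a local witness over the open
neighbourhood `U₁` of `X_max(N+1)`, which `sigmaMaxModification_of_localWitness` glues with the
identity of `X ∖ X_max(N+1)`.

## Sources

* V. Cossart, U. Jannsen, S. Saito, *Desingularization: Invariants and Strategy — Application
  to Dimension 2*, LNM 2270 (2020), Def. 2.28, Rem. 2.29 (b), Lemma 2.34, Def. 2.35, Lemma 2.36,
  Def. 6.15. [CossartJannsenSaito2020]
-/

set_option linter.dupNamespace false -- mandated namespace of this single-conjunct summit

noncomputable section

open CategoryTheory AlgebraicGeometry TopologicalSpace Topology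
open Literature.AlgebraicGeometry.Resolution Literature.RingTheory.HilbertSamuel

namespace Summit.ResolutionOfSingularities.ResolutionOfSingularities.Theorems.SigmaMaxModifications.Sketch

/-! ## Topology of the strata: the sub-level sets `{H^N_X ≤ μ}` are open -/

/-- **The sub-level set `{x | H^N_X(x) ≤ μ}` is open** when every `X(≥ λ)` is closed (upper
semicontinuity, CJS Thm. 2.33 (3)) and `Σ_X(N)` is finite (Lemma 2.36): its complement is the
finite union of the closed `X(≥ λ)` over the values `λ` with `¬ λ ≤ μ` (Lemma 2.34 (a)).
[cite: CossartJannsenSaito2020, Def. 6.15, Rem. 2.29 (b), Lemma 2.36] -/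
private theorem isOpen_setOf_hsFun_le {X : Scheme.{0}} {N : ℕ}
    (husc : ∀ ν : ℕ → ℕ, IsClosed (Scheme.hsStratumGE X N ν))
    (hfin : (Scheme.hsValues X N).Finite) (μ : ℕ → ℕ) :
    IsOpen {x : X | Scheme.hsFun X N x ≤ μ} := by
  have h : {x : X | Scheme.hsFun X N x ≤ μ}ᶜ =
      ⋃ ν ∈ {ν ∈ Scheme.hsValues X N | ¬ ν ≤ μ}, Scheme.hsStratumGE X N ν := by
    ext x
    simp only [Set.mem_compl_iff, Set.mem_setOf_eq, Set.mem_iUnion, Scheme.mem_hsStratumGE_iff,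
      exists_prop]
    exact ⟨fun hx => ⟨_, ⟨⟨x, rfl⟩, hx⟩, le_rfl⟩,
      fun ⟨ν, ⟨_, hνμ⟩, hνx⟩ hxμ => hνμ (hνx.trans hxμ)⟩
  rw [← isClosed_compl_iff, h]
  exact (hfin.subset (Set.sep_subset _ _)).isClosed_biUnion fun ν _ => husc ν

/-! ## Level transfer through the open `U₁ = {x | ∃ μ, μ^{(1)} ∈ Σ^max_X(N+1), H^N_X(x) ≤ μ}` -/

/-- If `μ^{(1)}` is a maximal value of `Σ_X(N+1)` and `dim X ≤ N`, then `μ` is a (maximal) value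
of `Σ_X(N)`: `μ^{(1)} = H^{N+1}_X(x) = (H^N_X(x))^{(1)}` and partial summation is injective
(CJS Rem. 2.29 (b)). [cite: CossartJannsenSaito2020, Def. 6.15, Rem. 2.29 (b), Lemma 2.36] -/
private theorem maximal_of_maximal_psum {X : Scheme.{0}} [IsLocallyNoetherian X] {N : ℕ}
    (hdim : topologicalKrullDim X ≤ (N : WithBot ℕ∞)) {μ : ℕ → ℕ}
    (hμ : Maximal (· ∈ Scheme.hsValues X (N + 1)) (psum μ)) :
    Maximal (· ∈ Scheme.hsValues X N) μ := by
  obtain ⟨x, hx⟩ := hμ.1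
  rw [Negative.hsFun_succ x (Negative.hsPsi_le_of_dim_le hdim x)] at hx
  exact Negative.maximal_of_maximal_psum_succ hdim ⟨x, psum_injective hx⟩ hμ

/-- **Maximal values of the open `U₁`.** For `dim X ≤ N` and the open
`U₁ = {x | ∃ μ, μ^{(1)} ∈ Σ^max_X(N+1), H^N_X(x) ≤ μ}`: a function `μ` is a maximal value of
`Σ_{U₁}(N)` iff `μ^{(1)}` is a maximal value of `Σ_X(N+1)`. (⇐) such a `μ` is a maximal value of
`Σ_X(N) ⊇ Σ_{U₁}(N)` attained at a point of `U₁`; (⇒) a maximal value `μ = H^N_X(u)`, `u ∈ U₁`,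
lies below some such `μ'`, which is a value of `Σ_{U₁}(N)`, so `μ = μ'`.
[cite: CossartJannsenSaito2020, Def. 6.15, Rem. 2.29 (b), Lemma 2.36] -/
private theorem maximal_hsValues_opens_iff {X : Scheme.{0}} [IsLocallyNoetherian X] {N : ℕ}
    (hdim : topologicalKrullDim X ≤ (N : WithBot ℕ∞)) {U₁ : X.Opens}
    (hU₁ : ∀ x : X, x ∈ U₁ ↔ ∃ μ : ℕ → ℕ,
      Maximal (· ∈ Scheme.hsValues X (N + 1)) (psum μ) ∧ Scheme.hsFun X N x ≤ μ)
    (μ : ℕ → ℕ) :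
    Maximal (· ∈ Scheme.hsValues (U₁ : Scheme.{0}) N) μ ↔
      Maximal (· ∈ Scheme.hsValues X (N + 1)) (psum μ) := by
  -- (⇐): a member of `S` is a value of `Σ_{U₁}(N)` and a maximal value of `Σ_X(N) ⊇ Σ_{U₁}(N)`
  have key : ∀ μ : ℕ → ℕ, Maximal (· ∈ Scheme.hsValues X (N + 1)) (psum μ) →
      Maximal (· ∈ Scheme.hsValues (U₁ : Scheme.{0}) N) μ := by
    intro μ hμ
    have hmax : Maximal (· ∈ Scheme.hsValues X N) μ := maximal_of_maximal_psum hdim hμ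
    obtain ⟨x, hx⟩ := hmax.1
    have hxU : x ∈ U₁ := (hU₁ x).mpr ⟨μ, hμ, hx.le⟩
    refine ⟨⟨⟨x, hxU⟩, ?_⟩, fun ν hν hle => ?_⟩
    · rw [Scheme.hsFun_opens]
      exact hx
    · exact hmax.2 (Scheme.hsValues_subset_of_isOpenImmersion U₁.ι N hν) hle
  refine ⟨fun hμ => ?_, key μ⟩
  obtain ⟨u, hu⟩ := hμ.1
  obtain ⟨μ', hμ', hle⟩ := (hU₁ u.1).mp u.2
  have hle' : μ ≤ μ' := by
    rw [← hu, Scheme.hsFun_opens]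
    exact hle
  have heq : μ = μ' := le_antisymm hle' (hμ.2 (key μ' hμ').1 hle')
  rw [heq]
  exact hμ'

/-- **`(U₁)_max(N) = U₁ ∩ X_max(N+1)`** for the open `U₁` above (`dim X ≤ N`): by
`maximal_hsValues_opens_iff`, `H^N_{U₁} = H^N_X|_{U₁}` (the Hilbert–Samuel function is local)
and `H^{N+1}_X = (H^N_X)^{(1)}`.
[cite: CossartJannsenSaito2020, Def. 6.15, Rem. 2.29 (b), Lemma 2.36] -/
private theorem mem_hsMaxLocus_opens_iff {X : Scheme.{0}} [IsLocallyNoetherian X] {N : ℕ}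
    (hdim : topologicalKrullDim X ≤ (N : WithBot ℕ∞)) {U₁ : X.Opens}
    (hU₁ : ∀ x : X, x ∈ U₁ ↔ ∃ μ : ℕ → ℕ,
      Maximal (· ∈ Scheme.hsValues X (N + 1)) (psum μ) ∧ Scheme.hsFun X N x ≤ μ)
    (u : (U₁ : Scheme.{0})) :
    u ∈ Scheme.hsMaxLocus (U₁ : Scheme.{0}) N ↔
      U₁.ι.base u ∈ Scheme.hsMaxLocus X (N + 1) := by
  rw [Scheme.mem_hsMaxLocus_iff, Scheme.mem_hsMaxLocus_iff, maximal_hsValues_opens_iff hdim hU₁,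
    Scheme.hsFun_opens, Negative.hsFun_succ _ (Negative.hsPsi_le_of_dim_le hdim _)]

/-- **`X_max(N+1) ⊆ U₁`** for the open `U₁` above (`dim X ≤ N`): for `x ∈ X_max(N+1)` the value
`μ = H^N_X(x)` has `μ^{(1)} = H^{N+1}_X(x)` maximal.
[cite: CossartJannsenSaito2020, Def. 6.15, Rem. 2.29 (b), Lemma 2.36] -/
private theorem hsMaxLocus_succ_subset_opens {X : Scheme.{0}} [IsLocallyNoetherian X] {N : ℕ}
    (hdim : topologicalKrullDim X ≤ (N : WithBot ℕ∞)) {U₁ : X.Opens}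
    (hU₁ : ∀ x : X, x ∈ U₁ ↔ ∃ μ : ℕ → ℕ,
      Maximal (· ∈ Scheme.hsValues X (N + 1)) (psum μ) ∧ Scheme.hsFun X N x ≤ μ) :
    ∀ x : X, x ∈ Scheme.hsMaxLocus X (N + 1) → x ∈ U₁ := by
  intro x hx
  rw [Scheme.mem_hsMaxLocus_iff, Negative.hsFun_succ x (Negative.hsPsi_le_of_dim_le hdim x)] at hx
  exact (hU₁ x).mpr ⟨_, hx, le_rfl⟩

/-! ## The induction step `N → N + 1` on the class `dim ≤ N` -/

/-- **Step `N → N + 1` of the level induction, dimension-free** (CJS Def. 6.15 at level `N + 1`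
from level `N`). Assume the crux body `B(Y, N)` for all `Y/k` reduced separated of finite type,
not regular, `dim Y ≤ N`, and let `X/k` be such with `dim X ≤ N`. The open
`U₁ = {x | ∃ μ, μ^{(1)} ∈ Σ^max_X(N+1), H^N_X(x) ≤ μ}` (open since the `X_N(≥ λ)` are closed at
`N ≥ dim X`, `stub_isClosed_hsMaxLocus_over_field` ∘ `stub_hsFun_le_of_specializes_over_field`,
and `Σ_X(N)` is finite) contains `X_max(N+1)`, satisfies `(U₁)_max(N) = U₁ ∩ X_max(N+1)`, and is
not regular (`∅ ≠ X_max(N+1) ⊆ Sing X`); the open subscheme `U₁ → X → Spec k` is separated (an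
open immersion followed by a separated morphism); `B(U₁, N)` read at level `N + 1`
(`H^{N+1} = (H^N)^{(1)}`, Rem. 2.29 (b): monotonicity and (ME2) move up, refuter kit
`Negative/Levels`) is a local witness which `sigmaMaxModification_of_localWitness` glues with the
identity of `X ∖ X_max(N+1)`.
[cite: CossartJannsenSaito2020, Def. 6.15, Rem. 2.29 (b), Lemma 2.36] -/
private theorem levelRaise_succ (k : Type) [Field k] (N : ℕ)
    (ih : ∀ (Y : Scheme.{0}) (g : Y ⟶ Spec (.of k)), IsSeparated g → LocallyOfFiniteType g →
      QuasiCompact g → IsReduced Y → ¬ Scheme.IsRegular Y →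
      topologicalKrullDim Y ≤ (N : WithBot ℕ∞) →
      ∃ (Y' : Scheme.{0}) (π : Y' ⟶ Y), IsProper π ∧ IsReduced Y' ∧
        topologicalKrullDim Y' ≤ (N : WithBot ℕ∞) ∧
        (∀ U : Y.Opens, (U : Set Y) ⊆ (Scheme.hsMaxLocus Y N)ᶜ → IsIso (π ∣_ U)) ∧
        Dense ((fun y' => π.base y') ⁻¹' (Scheme.hsMaxLocus Y N)ᶜ) ∧
        (∀ y' : Y', Scheme.hsFun Y' N y' ≤ Scheme.hsFun Y N (π.base y')) ∧
        ∀ ν : ℕ → ℕ, Maximal (· ∈ Scheme.hsValues Y N) ν → ν ∉ Scheme.hsValues Y' N)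
    (X : Scheme.{0}) (f : X ⟶ Spec (.of k)) (hsep : IsSeparated f) (hft : LocallyOfFiniteType f)
    (hqc : QuasiCompact f) (hred : IsReduced X) (hreg : ¬ Scheme.IsRegular X)
    (hdimN : topologicalKrullDim X ≤ (N : WithBot ℕ∞)) :
    ∃ (X' : Scheme.{0}) (π : X' ⟶ X), IsProper π ∧ IsReduced X' ∧
      topologicalKrullDim X' ≤ ((N + 1 : ℕ) : WithBot ℕ∞) ∧
      (∀ U : X.Opens, (U : Set X) ⊆ (Scheme.hsMaxLocus X (N + 1))ᶜ → IsIso (π ∣_ U)) ∧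
      Dense ((fun x' => π.base x') ⁻¹' (Scheme.hsMaxLocus X (N + 1))ᶜ) ∧
      (∀ x' : X', Scheme.hsFun X' (N + 1) x' ≤ Scheme.hsFun X (N + 1) (π.base x')) ∧
      ∀ ν : ℕ → ℕ, Maximal (· ∈ Scheme.hsValues X (N + 1)) ν →
        ν ∉ Scheme.hsValues X' (N + 1) := by
  haveI := hsep
  haveI := hft
  haveI := hqc
  haveI := hred
  haveI : IsLocallyNoetherian X := LocallyOfFiniteType.isLocallyNoetherian f
  haveI : IsNoetherian X := Scheme.isNoetherian_of_finiteType_over_field f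
  have hexc : Scheme.IsExcellent X :=
    Scheme.isExcellent_of_locallyOfFiniteType Stacks07QW_field_holds f
  have hdimN1 : topologicalKrullDim X ≤ ((N + 1 : ℕ) : WithBot ℕ∞) :=
    hdimN.trans (by exact_mod_cast N.le_succ)
  have hψ : ∀ x : X, Scheme.hsPsi X x ≤ N := Negative.hsPsi_le_of_dim_le hdimN
  have hψ1 : ∀ x : X, Scheme.hsPsi X x ≤ N + 1 := fun x => (hψ x).trans N.le_succ
  have hcl := stub_isClosed_hsMaxLocus_over_field stub_hsFun_le_of_specializes_over_field k X f
    hft hqc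
  have hfin : (Scheme.hsValues X N).Finite := Scheme.finite_hsValues_of_isExcellent hexc N hψ
  have hfin1 : (Scheme.hsValues X (N + 1)).Finite :=
    Scheme.finite_hsValues_of_isExcellent hexc (N + 1) hψ1
  -- the open neighbourhood `U₁` of `X_max(N+1)`
  obtain ⟨U₁, hU₁⟩ : ∃ U₁ : X.Opens, ∀ x : X, x ∈ U₁ ↔ ∃ μ : ℕ → ℕ,
      Maximal (· ∈ Scheme.hsValues X (N + 1)) (psum μ) ∧ Scheme.hsFun X N x ≤ μ :=
    ⟨⟨⋃ μ ∈ {μ : ℕ → ℕ | Maximal (· ∈ Scheme.hsValues X (N + 1)) (psum μ)},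
        {x : X | Scheme.hsFun X N x ≤ μ},
      isOpen_biUnion fun μ _ => isOpen_setOf_hsFun_le (hcl N hdimN).1 hfin μ⟩,
      fun x => by simp only [Opens.mem_mk, Set.mem_iUnion, Set.mem_setOf_eq, exists_prop]⟩
  have hsub : ∀ x : X, x ∈ Scheme.hsMaxLocus X (N + 1) → x ∈ U₁ :=
    hsMaxLocus_succ_subset_opens hdimN hU₁
  have hmaxU : ∀ u : (U₁ : Scheme.{0}), u ∈ Scheme.hsMaxLocus (U₁ : Scheme.{0}) N ↔
      U₁.ι.base u ∈ Scheme.hsMaxLocus X (N + 1) := mem_hsMaxLocus_opens_iff hdimN hU₁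
  -- the open complement of `X_max(N+1)`; `Zc ∪ U₁ = X`
  obtain ⟨Zc, hZc⟩ : ∃ Zc : X.Opens, (Zc : Set X) = (Scheme.hsMaxLocus X (N + 1))ᶜ :=
    ⟨⟨_, (hcl (N + 1) hdimN1).2.isOpen_compl⟩, rfl⟩
  have hmemZc : ∀ x : X, x ∈ Zc ↔ x ∉ Scheme.hsMaxLocus X (N + 1) := fun x => by
    rw [← SetLike.mem_coe, hZc, Set.mem_compl_iff]
  have hcover : Zc ⊔ U₁ = ⊤ := by
    ext x
    simp only [Opens.coe_sup, Set.mem_union, SetLike.mem_coe, Opens.coe_top, Set.mem_univ,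
      iff_true]
    by_cases hx : x ∈ Scheme.hsMaxLocus X (N + 1)
    · exact Or.inr (hsub x hx)
    · exact Or.inl ((hmemZc x).mpr hx)
  -- `U₁` is not regular: it contains the non-empty `X_max(N+1) ⊆ Sing X`
  have hUreg : ¬ Scheme.IsRegular (U₁ : Scheme.{0}) := by
    obtain ⟨x₀, _⟩ := not_forall.mp hreg
    haveI : Nonempty X := ⟨x₀⟩
    obtain ⟨x, hx⟩ := Scheme.hsMaxLocus_nonempty_of_finite (X := X) hfin1
    have hxreg : x ∉ Scheme.regularLocus X :=
      Scheme.hsMaxLocus_subset_compl_regularLocus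
        (fun x => exists_ringKrullDim_stalk_eq_of_topologicalKrullDim_le hdimN1 x) hreg hx
    intro hU
    haveI := hU ⟨x, hsub x hx⟩
    exact hxreg (IsRegularLocalRing.of_ringEquiv
      (asIso (U₁.ι.stalkMap ⟨x, hsub x hx⟩)).commRingCatIsoToRingEquiv.symm)
  -- the hypothesis on the open subscheme `U₁` (separated: open immersion, then `f`)
  have hUdimN : topologicalKrullDim (U₁ : Scheme.{0}) ≤ (N : WithBot ℕ∞) :=
    (topologicalKrullDim_subspace_le X (U₁ : Set X)).trans hdimN
  obtain ⟨Y, ρ, hprop, hYred, hYdim, hiso, hdense, hmono, hkill⟩ :=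
    ih (U₁ : Scheme.{0}) (U₁.ι ≫ f) inferInstance inferInstance inferInstance inferInstance
      hUreg hUdimN
  haveI := hprop
  haveI : IsLocallyNoetherian Y := LocallyOfFiniteType.isLocallyNoetherian ρ
  have hψY : ∀ y : Y, Scheme.hsPsi Y y ≤ N := Negative.hsPsi_le_of_dim_le hYdim
  -- glue the level-`N` witness over `U₁`, read at level `N + 1`, with the identity of `Zc`
  refine sigmaMaxModification_of_localWitness X (N + 1) hdimN1 Zc U₁ hZc hcover Y ρ hprop hYred
    (hYdim.trans (by exact_mod_cast N.le_succ)) ?_ ?_ ?_ ?_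
  · -- `ρ` is an isomorphism over `U₁ ∩ Zc = U₁ ∖ (U₁)_max(N)`
    refine hiso _ fun u hu hu' => ?_
    have hu₂ : U₁.ι.base u ∈ Zc := hu
    exact (hmemZc _).mp hu₂ ((hmaxU u).mp hu')
  · -- the preimage of `U₁ ∩ Zc` is the (dense) preimage of `U₁ ∖ (U₁)_max(N)`
    refine hdense.mono fun y hy => ?_
    show U₁.ι.base (ρ.base y) ∈ Zc
    exact (hmemZc _).mpr fun h => hy ((hmaxU _).mpr h)
  · -- `H^{N+1}` does not increase
    intro y
    refine Negative.hsFun_succ_le_of_le (hψ _) (hψY y) ?_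
    rw [← Scheme.hsFun_opens U₁ N (ρ.base y)]
    exact hmono y
  · -- (ME2) at level `N + 1`
    rintro ν hν ⟨y, hy⟩
    rw [Negative.hsFun_succ y (hψY y)] at hy
    subst hy
    exact hkill _ ((maximal_hsValues_opens_iff hdimN hU₁ _).mpr hν) ⟨y, rfl⟩

/-! ## The stub -/

/-- **STUB `stub_levelRaise` (line `Sketch`, provable): level raising `N → N + 1` on the class
`dim ≤ N`.** If the crux body `B(Y, N)` holds for every reduced separated finite-type non-regular
`Y/k` with `dim Y ≤ N`, then `B(X, N + 1)` holds for every such `X` with `dim X ≤ N`. With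
`U₁ = {x | ∃ μ, μ^{(1)} ∈ Σ^max_X(N+1), H^N_X(x) ≤ μ}` — open (each `{H^N_X ≤ μ}` is the
complement of the finite union of the closed `X_N(≥ λ)`, `λ ∈ Σ_X(N)` not below `μ`;
closedness is the sharp semicontinuity `stub_isClosed_hsMaxLocus_over_field` ∘
`stub_hsFun_le_of_specializes_over_field` at `N ≥ dim X`, finiteness is
`Scheme.finite_hsValues_of_isExcellent`), `X_max(N+1) ⊆ U₁`, `(U₁)_max(N) = U₁ ∩ X_max(N+1)`,
`U₁` not regular and separated of finite type over `k` — the hypothesis applied to the open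
subscheme `U₁` and read at level `N + 1` along `ν ↦ ν^{(1)}` (`Negative.hsFun_succ`,
`Negative.hsFun_succ_le_of_le`) is a local witness over `U₁`, which
`sigmaMaxModification_of_localWitness` glues with the identity of `X ∖ X_max(N+1)`
(`levelRaise_succ`). [cite: CossartJannsenSaito2020, Def. 6.15, Rem. 2.29 (b), Lemma 2.36] -/
theorem stub_levelRaise :
    ∀ (k : Type) [Field k] (N : ℕ),
      (∀ (Y : Scheme.{0}) (g : Y ⟶ Spec (.of k)), IsSeparated g → LocallyOfFiniteType g →
        QuasiCompact g → IsReduced Y → ¬ Scheme.IsRegular Y →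
        topologicalKrullDim Y ≤ (N : WithBot ℕ∞) →
        ∃ (Y' : Scheme.{0}) (π : Y' ⟶ Y), IsProper π ∧ IsReduced Y' ∧
          topologicalKrullDim Y' ≤ (N : WithBot ℕ∞) ∧
          (∀ U : Y.Opens, (U : Set Y) ⊆ (Scheme.hsMaxLocus Y N)ᶜ → IsIso (π ∣_ U)) ∧
          Dense ((fun y' => π.base y') ⁻¹' (Scheme.hsMaxLocus Y N)ᶜ) ∧
          (∀ y' : Y', Scheme.hsFun Y' N y' ≤ Scheme.hsFun Y N (π.base y')) ∧
          ∀ ν : ℕ → ℕ, Maximal (· ∈ Scheme.hsValues Y N) ν → ν ∉ Scheme.hsValues Y' N) →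
      ∀ (X : Scheme.{0}) (f : X ⟶ Spec (.of k)), IsSeparated f → LocallyOfFiniteType f →
        QuasiCompact f → IsReduced X → ¬ Scheme.IsRegular X →
        topologicalKrullDim X ≤ (N : WithBot ℕ∞) →
        ∃ (X' : Scheme.{0}) (π : X' ⟶ X), IsProper π ∧ IsReduced X' ∧
          topologicalKrullDim X' ≤ ((N + 1 : ℕ) : WithBot ℕ∞) ∧
          (∀ U : X.Opens, (U : Set X) ⊆ (Scheme.hsMaxLocus X (N + 1))ᶜ → IsIso (π ∣_ U)) ∧
          Dense ((fun x' => π.base x') ⁻¹' (Scheme.hsMaxLocus X (N + 1))ᶜ) ∧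
          (∀ x' : X', Scheme.hsFun X' (N + 1) x' ≤ Scheme.hsFun X (N + 1) (π.base x')) ∧
          ∀ ν : ℕ → ℕ, Maximal (· ∈ Scheme.hsValues X (N + 1)) ν →
            ν ∉ Scheme.hsValues X' (N + 1) := by
  intro k _ N ih X f hsep hft hqc hred hreg hdimN
  exact levelRaise_succ k N ih X f hsep hft hqc hred hreg hdimN

end Summit.ResolutionOfSingularities.ResolutionOfSingularities.Theorems.SigmaMaxModifications.Sketch

end
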